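import Summits.CriticalPhenomena.PercolationContinuityZ3.Theorems.PercNearOneGluingNoHeavyLowerTailAPLPendantCells
import HarnessLib

/-!
# `NoHeavyLowerTail` (stmt-CriticalPhenomena-4575) — the graph ↔ cells dictionary, IV: cells of the base pieces (an `a`-free piece, a single `a–b` or `a–c` edge)

Support file (prover prim-ineq-gen-8 gen 36; `--supports stmt-CriticalPhenomena-4575`; memo
run/shared/lean/prim/prim-ineq-gen-8/FINDING-gen36-LEMMA-U.md §4, step (D3)).  No definitions, no named facts, no sorries.

The base pieces of the forest decomposition of memo gen 34 §2, with cells written as `DecisionTree.PrW` of the cluster events as in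
`…APLGluedCells.lean` / `…APLPendantCells.lean`:
* `afree_cell_*` — a piece none of whose edges contains the apex `a` has cell vector `(P(b ↮ c), 0, 0, P(b ↔ c), 0)`; glued to another
  piece (union lemma `glued_cell_*`) it acts as the independent `b–c` connector of `conjF_c_bcConnector` / `geom_bc_edge`.
* `PrW_single_edge` — `PrW {e} p X = p_e·1[{e} ∈ X] + (1 − p_e)·1[∅ ∈ X]`; `empty_cl_facts`, `bEdge_cl_facts`, `cEdge_cl_facts` — the clusters
  of the empty configuration and of a single edge among three distinct terminals.
* `bEdge_cell_*`, `cEdge_cell_*` — a single `a–b` edge of weight `x` has cells `(1−x, x, 0, 0, 0)`, a single `a–c` edge `(1−x, 0, x, 0, 0)`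
  (the pieces of LEMMA E, `conjF_c_union_abEdge` / `…acEdge`).
[folklore]
-/

namespace Summit.CriticalPhenomena.PercolationContinuityZ3.Theorems

namespace APL

open Literature.Probability.Percolation Literature.Probability.Percolation.Gladkov Literature.Probability.Percolation.DecisionTree
open scoped Classical

variable {V : Type*} [Fintype V] [DecidableEq V]

/-- Cells of an `a`-FREE piece (no edge of `D` contains the apex), cell `a|b|c`: the piece only records whether `b ↔ c`
(cell vector `(P(b ↮ c), 0, 0, P(b ↔ c), 0)`; its union with another piece is the `b–c` connector map of `conjF_c_bcConnector`). [folklore] -/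
theorem afree_cell_zero (p : Sym2 V → ℝ) (D : Finset (Sym2 V)) (a b c : V) (hba : b ≠ a) (hca : c ≠ a)
    (hD : ∀ f ∈ D, a ∉ f) :
    PrW D p {K : Finset (Sym2 V) | b ∉ cl K a ∧ c ∉ cl K a ∧ c ∉ cl K b} = PrW D p {K : Finset (Sym2 V) | c ∉ cl K b} := by
  refine PrW_congr_set _ p fun L hL => ?_
  have hLa : ∀ f ∈ L, a ∉ f := fun f hf => hD f (hL hf)
  simp only [Set.mem_setOf_eq, pendant_not_mem_cl hLa hba, pendant_not_mem_cl hLa hca, not_false_eq_true, true_and]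

/-- Cells of an `a`-FREE piece (no edge of `D` contains the apex), cell `ab|c`: the piece only records whether `b ↔ c`
(cell vector `(P(b ↮ c), 0, 0, P(b ↔ c), 0)`; its union with another piece is the `b–c` connector map of `conjF_c_bcConnector`). [folklore] -/
theorem afree_cell_ab (p : Sym2 V → ℝ) (D : Finset (Sym2 V)) (a b c : V) (hba : b ≠ a)
    (hD : ∀ f ∈ D, a ∉ f) :
    PrW D p {K : Finset (Sym2 V) | b ∈ cl K a ∧ c ∉ cl K a} = 0 := by
  refine PrW_eq_zero_of_forall_not_mem _ p fun L hL hmem => ?_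
  have hLa : ∀ f ∈ L, a ∉ f := fun f hf => hD f (hL hf)
  simp only [Set.mem_setOf_eq] at hmem
  exact pendant_not_mem_cl hLa hba hmem.1

/-- Cells of an `a`-FREE piece (no edge of `D` contains the apex), cell `ac|b`: the piece only records whether `b ↔ c`
(cell vector `(P(b ↮ c), 0, 0, P(b ↔ c), 0)`; its union with another piece is the `b–c` connector map of `conjF_c_bcConnector`). [folklore] -/
theorem afree_cell_ac (p : Sym2 V → ℝ) (D : Finset (Sym2 V)) (a b c : V) (hca : c ≠ a)
    (hD : ∀ f ∈ D, a ∉ f) :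
    PrW D p {K : Finset (Sym2 V) | c ∈ cl K a ∧ b ∉ cl K a} = 0 := by
  refine PrW_eq_zero_of_forall_not_mem _ p fun L hL hmem => ?_
  have hLa : ∀ f ∈ L, a ∉ f := fun f hf => hD f (hL hf)
  simp only [Set.mem_setOf_eq] at hmem
  exact pendant_not_mem_cl hLa hca hmem.1

/-- Cells of an `a`-FREE piece (no edge of `D` contains the apex), cell `a|bc`: the piece only records whether `b ↔ c`
(cell vector `(P(b ↮ c), 0, 0, P(b ↔ c), 0)`; its union with another piece is the `b–c` connector map of `conjF_c_bcConnector`). [folklore] -/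
theorem afree_cell_bc (p : Sym2 V → ℝ) (D : Finset (Sym2 V)) (a b c : V) (hba : b ≠ a) (hca : c ≠ a)
    (hD : ∀ f ∈ D, a ∉ f) :
    PrW D p {K : Finset (Sym2 V) | b ∉ cl K a ∧ c ∉ cl K a ∧ c ∈ cl K b} = PrW D p {K : Finset (Sym2 V) | c ∈ cl K b} := by
  refine PrW_congr_set _ p fun L hL => ?_
  have hLa : ∀ f ∈ L, a ∉ f := fun f hf => hD f (hL hf)
  simp only [Set.mem_setOf_eq, pendant_not_mem_cl hLa hba, pendant_not_mem_cl hLa hca, not_false_eq_true, true_and]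

/-- Cells of an `a`-FREE piece (no edge of `D` contains the apex), cell `abc`: the piece only records whether `b ↔ c`
(cell vector `(P(b ↮ c), 0, 0, P(b ↔ c), 0)`; its union with another piece is the `b–c` connector map of `conjF_c_bcConnector`). [folklore] -/
theorem afree_cell_three (p : Sym2 V → ℝ) (D : Finset (Sym2 V)) (a b c : V) (hba : b ≠ a)
    (hD : ∀ f ∈ D, a ∉ f) :
    PrW D p {K : Finset (Sym2 V) | b ∈ cl K a ∧ c ∈ cl K a} = 0 := by
  refine PrW_eq_zero_of_forall_not_mem _ p fun L hL hmem => ?_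
  have hLa : ∀ f ∈ L, a ∉ f := fun f hf => hD f (hL hf)
  simp only [Set.mem_setOf_eq] at hmem
  exact pendant_not_mem_cl hLa hba hmem.1

omit [Fintype V] in
/-- `PrW` over a single coordinate. [folklore] -/
theorem PrW_single_edge (p : Sym2 V → ℝ) (e : Sym2 V) (X : Set (Finset (Sym2 V))) :
    PrW ({e} : Finset (Sym2 V)) p X = p e * ind X {e} + (1 - p e) * ind X ∅ := by
  have he : e ∈ ({e} : Finset (Sym2 V)) := Finset.mem_singleton_self e
  rw [DTree2.PrW_split _ p he, Fintype.sum_bool]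
  simp only [DTree2.wt1, if_true, Bool.false_eq_true, if_false, Finset.erase_singleton]
  have h0 : ∀ Y : Set (Finset (Sym2 V)), PrW (∅ : Finset (Sym2 V)) p Y = ind Y ∅ := fun Y => by
    rw [PrW_eq_sum_ind, Finset.powerset_empty, Finset.sum_singleton]
    simp [wtW]
  rw [h0, h0]
  simp [DTree2.ins, ind]

omit [DecidableEq V] in
/-- Clusters of the empty configuration among three distinct vertices: nobody is joined. [folklore] -/
theorem empty_cl_facts (a b c : V) (hab : a ≠ b) (hac : a ≠ c) (hbc : b ≠ c) :
    b ∉ cl (∅ : Finset (Sym2 V)) a ∧ c ∉ cl (∅ : Finset (Sym2 V)) a ∧ c ∉ cl (∅ : Finset (Sym2 V)) b :=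
  ⟨pendant_not_mem_cl (fun f hf => absurd hf (Finset.notMem_empty f)) hab.symm,
   pendant_not_mem_cl (fun f hf => absurd hf (Finset.notMem_empty f)) hac.symm,
   pendant_not_mem_cl (fun f hf => absurd hf (Finset.notMem_empty f)) hbc.symm⟩

omit [DecidableEq V] in
/-- The cluster of an endpoint of a single edge is contained in the edge. [folklore] -/
theorem cl_single_edge_subset (x y v : V) (hv : v ∈ cl ({s(x, y)} : Finset (Sym2 V)) x) : v = x ∨ v = y := by
  have hclosed : ∀ u w, u ∈ ({x, y} : Finset V) → (openGraph (↑({s(x, y)} : Finset (Sym2 V)) : Set (Sym2 V))).Adj u w →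
      w ∈ ({x, y} : Finset V) := by
    intro u w _ huw
    rw [adj_iff, Finset.mem_singleton] at huw
    rcases Sym2.eq_iff.1 huw.1 with ⟨_, hw⟩ | ⟨_, hw⟩
    · rw [hw]; simp
    · rw [hw]; simp
  rw [mem_cl] at hv
  obtain ⟨w⟩ := hv
  have := mem_of_walk hclosed w (by simp)
  simpa [Finset.mem_insert, Finset.mem_singleton] using this

omit [DecidableEq V] in
/-- Clusters of a single `a–b` edge among three distinct terminals: `a ↔ b`, `a ↮ c`, `b ↮ c`. [folklore] -/
theorem bEdge_cl_facts (a b c : V) (hab : a ≠ b) (hac : a ≠ c) (hbc : b ≠ c) :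
    b ∈ cl ({s(a, b)} : Finset (Sym2 V)) a ∧ c ∉ cl ({s(a, b)} : Finset (Sym2 V)) a ∧ c ∉ cl ({s(a, b)} : Finset (Sym2 V)) b := by
  refine ⟨mem_cl_of_adj (mem_cl_self _ _) (adj_iff.2 ⟨Finset.mem_singleton_self _, hab⟩), fun h => ?_, fun h => ?_⟩
  · rcases cl_single_edge_subset a b c h with h | h
    · exact hac h.symm
    · exact hbc h.symm
  · have h' : c ∈ cl ({s(b, a)} : Finset (Sym2 V)) b := by rw [Sym2.eq_swap]; exact h
    rcases cl_single_edge_subset b a c h' with h | h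
    · exact hbc h.symm
    · exact hac h.symm

omit [DecidableEq V] in
/-- Clusters of a single `a–c` edge among three distinct terminals: `a ↔ c`, `a ↮ b`, `b ↮ c`. [folklore] -/
theorem cEdge_cl_facts (a b c : V) (hab : a ≠ b) (hac : a ≠ c) (hbc : b ≠ c) :
    b ∉ cl ({s(a, c)} : Finset (Sym2 V)) a ∧ c ∈ cl ({s(a, c)} : Finset (Sym2 V)) a ∧ c ∉ cl ({s(a, c)} : Finset (Sym2 V)) b := by
  refine ⟨fun h => ?_, mem_cl_of_adj (mem_cl_self _ _) (adj_iff.2 ⟨Finset.mem_singleton_self _, hac⟩), fun h => ?_⟩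
  · rcases cl_single_edge_subset a c b h with h | h
    · exact hab h.symm
    · exact hbc h
  · have hb : b ∈ cl ({s(a, c)} : Finset (Sym2 V)) c := mem_cl_comm.1 h
    have hb' : b ∈ cl ({s(c, a)} : Finset (Sym2 V)) c := by rw [Sym2.eq_swap]; exact hb
    rcases cl_single_edge_subset c a b hb' with h | h
    · exact hbc h
    · exact hab h.symm

/-- Cells of a single `a–b` edge of weight `x = p s(a,b)`, cell `a|b|c`: the cell vector is `(1−x, x, 0, 0, 0)`
(LEMMA E pieces of `…APLConjF.lean`). [folklore] -/
theorem bEdge_cell_zero (p : Sym2 V → ℝ) (a b c : V) (hab : a ≠ b) (hac : a ≠ c) (hbc : b ≠ c) :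
    PrW ({s(a, b)} : Finset (Sym2 V)) p {K : Finset (Sym2 V) | b ∉ cl K a ∧ c ∉ cl K a ∧ c ∉ cl K b} = 1 - p s(a, b) := by
  have hcl1 := bEdge_cl_facts a b c hab hac hbc
  have hcl0 := empty_cl_facts a b c hab hac hbc
  rw [PrW_single_edge]
  simp only [ind, Set.mem_setOf_eq, hcl1, hcl0]
  norm_num

/-- Cells of a single `a–b` edge of weight `x = p s(a,b)`, cell `ab|c`: the cell vector is `(1−x, x, 0, 0, 0)`
(LEMMA E pieces of `…APLConjF.lean`). [folklore] -/
theorem bEdge_cell_ab (p : Sym2 V → ℝ) (a b c : V) (hab : a ≠ b) (hac : a ≠ c) (hbc : b ≠ c) :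
    PrW ({s(a, b)} : Finset (Sym2 V)) p {K : Finset (Sym2 V) | b ∈ cl K a ∧ c ∉ cl K a} = p s(a, b) := by
  have hcl1 := bEdge_cl_facts a b c hab hac hbc
  have hcl0 := empty_cl_facts a b c hab hac hbc
  rw [PrW_single_edge]
  simp only [ind, Set.mem_setOf_eq, hcl1, hcl0]
  norm_num

/-- Cells of a single `a–b` edge of weight `x = p s(a,b)`, cell `ac|b`: the cell vector is `(1−x, x, 0, 0, 0)`
(LEMMA E pieces of `…APLConjF.lean`). [folklore] -/
theorem bEdge_cell_ac (p : Sym2 V → ℝ) (a b c : V) (hab : a ≠ b) (hac : a ≠ c) (hbc : b ≠ c) :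
    PrW ({s(a, b)} : Finset (Sym2 V)) p {K : Finset (Sym2 V) | c ∈ cl K a ∧ b ∉ cl K a} = 0 := by
  have hcl1 := bEdge_cl_facts a b c hab hac hbc
  have hcl0 := empty_cl_facts a b c hab hac hbc
  rw [PrW_single_edge]
  simp only [ind, Set.mem_setOf_eq, hcl1, hcl0]
  norm_num

/-- Cells of a single `a–b` edge of weight `x = p s(a,b)`, cell `a|bc`: the cell vector is `(1−x, x, 0, 0, 0)`
(LEMMA E pieces of `…APLConjF.lean`). [folklore] -/
theorem bEdge_cell_bc (p : Sym2 V → ℝ) (a b c : V) (hab : a ≠ b) (hac : a ≠ c) (hbc : b ≠ c) :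
    PrW ({s(a, b)} : Finset (Sym2 V)) p {K : Finset (Sym2 V) | b ∉ cl K a ∧ c ∉ cl K a ∧ c ∈ cl K b} = 0 := by
  have hcl1 := bEdge_cl_facts a b c hab hac hbc
  have hcl0 := empty_cl_facts a b c hab hac hbc
  rw [PrW_single_edge]
  simp only [ind, Set.mem_setOf_eq, hcl1, hcl0]
  norm_num

/-- Cells of a single `a–b` edge of weight `x = p s(a,b)`, cell `abc`: the cell vector is `(1−x, x, 0, 0, 0)`
(LEMMA E pieces of `…APLConjF.lean`). [folklore] -/
theorem bEdge_cell_three (p : Sym2 V → ℝ) (a b c : V) (hab : a ≠ b) (hac : a ≠ c) (hbc : b ≠ c) :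
    PrW ({s(a, b)} : Finset (Sym2 V)) p {K : Finset (Sym2 V) | b ∈ cl K a ∧ c ∈ cl K a} = 0 := by
  have hcl1 := bEdge_cl_facts a b c hab hac hbc
  have hcl0 := empty_cl_facts a b c hab hac hbc
  rw [PrW_single_edge]
  simp only [ind, Set.mem_setOf_eq, hcl1, hcl0]
  norm_num


/-- Cells of a single `a–c` edge of weight `x = p s(a,c)`, cell `a|b|c`: the cell vector is `(1−x, 0, x, 0, 0)`
(LEMMA E pieces of `…APLConjF.lean`). [folklore] -/
theorem cEdge_cell_zero (p : Sym2 V → ℝ) (a b c : V) (hab : a ≠ b) (hac : a ≠ c) (hbc : b ≠ c) :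
    PrW ({s(a, c)} : Finset (Sym2 V)) p {K : Finset (Sym2 V) | b ∉ cl K a ∧ c ∉ cl K a ∧ c ∉ cl K b} = 1 - p s(a, c) := by
  have hcl1 := cEdge_cl_facts a b c hab hac hbc
  have hcl0 := empty_cl_facts a b c hab hac hbc
  rw [PrW_single_edge]
  simp only [ind, Set.mem_setOf_eq, hcl1, hcl0]
  norm_num

/-- Cells of a single `a–c` edge of weight `x = p s(a,c)`, cell `ab|c`: the cell vector is `(1−x, 0, x, 0, 0)`
(LEMMA E pieces of `…APLConjF.lean`). [folklore] -/
theorem cEdge_cell_ab (p : Sym2 V → ℝ) (a b c : V) (hab : a ≠ b) (hac : a ≠ c) (hbc : b ≠ c) :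
    PrW ({s(a, c)} : Finset (Sym2 V)) p {K : Finset (Sym2 V) | b ∈ cl K a ∧ c ∉ cl K a} = 0 := by
  have hcl1 := cEdge_cl_facts a b c hab hac hbc
  have hcl0 := empty_cl_facts a b c hab hac hbc
  rw [PrW_single_edge]
  simp only [ind, Set.mem_setOf_eq, hcl1, hcl0]
  norm_num

/-- Cells of a single `a–c` edge of weight `x = p s(a,c)`, cell `ac|b`: the cell vector is `(1−x, 0, x, 0, 0)`
(LEMMA E pieces of `…APLConjF.lean`). [folklore] -/
theorem cEdge_cell_ac (p : Sym2 V → ℝ) (a b c : V) (hab : a ≠ b) (hac : a ≠ c) (hbc : b ≠ c) :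
    PrW ({s(a, c)} : Finset (Sym2 V)) p {K : Finset (Sym2 V) | c ∈ cl K a ∧ b ∉ cl K a} = p s(a, c) := by
  have hcl1 := cEdge_cl_facts a b c hab hac hbc
  have hcl0 := empty_cl_facts a b c hab hac hbc
  rw [PrW_single_edge]
  simp only [ind, Set.mem_setOf_eq, hcl1, hcl0]
  norm_num

/-- Cells of a single `a–c` edge of weight `x = p s(a,c)`, cell `a|bc`: the cell vector is `(1−x, 0, x, 0, 0)`
(LEMMA E pieces of `…APLConjF.lean`). [folklore] -/
theorem cEdge_cell_bc (p : Sym2 V → ℝ) (a b c : V) (hab : a ≠ b) (hac : a ≠ c) (hbc : b ≠ c) :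
    PrW ({s(a, c)} : Finset (Sym2 V)) p {K : Finset (Sym2 V) | b ∉ cl K a ∧ c ∉ cl K a ∧ c ∈ cl K b} = 0 := by
  have hcl1 := cEdge_cl_facts a b c hab hac hbc
  have hcl0 := empty_cl_facts a b c hab hac hbc
  rw [PrW_single_edge]
  simp only [ind, Set.mem_setOf_eq, hcl1, hcl0]
  norm_num

/-- Cells of a single `a–c` edge of weight `x = p s(a,c)`, cell `abc`: the cell vector is `(1−x, 0, x, 0, 0)`
(LEMMA E pieces of `…APLConjF.lean`). [folklore] -/
theorem cEdge_cell_three (p : Sym2 V → ℝ) (a b c : V) (hab : a ≠ b) (hac : a ≠ c) (hbc : b ≠ c) :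
    PrW ({s(a, c)} : Finset (Sym2 V)) p {K : Finset (Sym2 V) | b ∈ cl K a ∧ c ∈ cl K a} = 0 := by
  have hcl1 := cEdge_cl_facts a b c hab hac hbc
  have hcl0 := empty_cl_facts a b c hab hac hbc
  rw [PrW_single_edge]
  simp only [ind, Set.mem_setOf_eq, hcl1, hcl0]
  norm_num

end APL

end Summit.CriticalPhenomena.PercolationContinuityZ3.Theorems
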